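import Summits.Langlands.Langlands.Theses.StickelbergerDial
import HarnessLib

/-!
# Disproof of `UnramifiedFermatWitness` — findings (cdisprove seat `cdisprove-stmt-Langlands-18025`, cycle 1, 2026-08-17)

Crux: `Summit.Langlands.Langlands.Theses.StickelbergerDial.UnramifiedFermatWitness` (item
stmt-Langlands-18025, route `Langlands/StickelbergerDial`, rank 2, "THE DOOR"): ℓ-unramified
potential RESIDUAL automorphy in weight 0 of a crystalline weight-0 `r : Γ_K → GL_n(ℚ̄_ℓ)` over a CM
field `K` (hypotheses of ACC+ Thm 6.1.1 minus the automorphic witness), delivered over a CM Galois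
`K'/K` with `ℓ` UNRAMIFIED in `K'` together with the whole 6.1.1 hypothesis bundle over `K'`.

## VERDICT OF THIS CYCLE: NO KILL — and why it resists

* MATHEMATICALLY the crux is a consequence of the generalised Serre conjecture for `GL_n` over CM
  fields with its weight part (the crystalline lift `r|Γ_{K_v}` of labelled weights `{0,…,n−1}`,
  `ℓ > n` unramified, makes the trivial Serre weight a predicted weight of `r̄`, so `r̄` should be
  automorphic of weight 0 and level prime to `ℓ` over `K` ITSELF, `K' = K`), plus the existence of
  HLTT Galois representations.  No counterexample is expected; none of the degenerate regimes below
  produces one.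
* FORMALLY no instance of the hypothesis bundle is constructible in the tree: it needs an
  `n ≥ 2`-dimensional residually absolutely irreducible `r` together with a PROOF that `r|Γ_{K_v}` is
  crystalline of labelled weights `{0,…,n−1}` for THE ε-pinned datum `fontainePstAdicCompletion v ℓ hv`
  (clauses (F1)–(F12) of `IsFontaineDatum` certify de Rham-ness/weights only for unramified,
  finite-image and cyclotomic-power representations: finite image ⇒ weights `replicate n 0 ≠ range n`;
  sums of cyclotomic powers ⇒ `τ` reducible).  Hence NO `_false_without_<H>` lemma of the
  instance-exhibiting kind can be kernel-checked for this crux today (same wall as the birth attack,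
  item note of refuter-rattack-stmt-Langlands-18025-0), and the conclusion is not junk-satisfiable
  (`CuspidalAutomorphicRepData`: `W' < W`, stable, irreducible; `HasSatakeParamAt` needs an eigenform
  in `W ∖ W'`).
* What this file DOES establish (all `sorry`-free below):
  §1 reading of the statement — no mis-typing found; the hypothesis `2 * n < ℓ` is decorative
     (`unramifiedFermatWitness_without_two_mul_lt`); the HLTT clause's normalisation is the only
     consistent one (`no_weight_reflection`);
  §2 THE DIAL OBSTRUCTION (main finding, small-model computation + exact identity
     `fermatHodge_neg`): the route's first attack — Stickelberger dial at the FERMAT point, `t ≡ 0`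
     at every `w ∣ ℓ` — produces witnesses that are LOCALLY POLARISED above `ℓ`: for every `v ∣ ℓ`
     of `K`, `type(r̄ᶜ|_{I_v}) = dual type(r̄|_{I_v})` (digits `d ↦ (n−1)−d`).  Automatic for
     polarisable `r`; a genuine, positive-codimension-free exclusion for the non-polarisable `r` the
     route exists for (e.g. `n = 3`, `ℓ` split in `K`, niveau-3 cycle `(0,1,2)` at both `v` and `cv`;
     `n = 3`, `ℓ` inert, niveau-1-over-`ℚ_{ℓ²}` pairing `π = (01)`).  So layer-2
     `FermatInertialDial → UnramifiedFermatWitness` cannot close the crux as stated; the other residue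
     discs (`|t_w| = 1`, Hasse–Witt strata, card `torsion-period-dial`) or a laundering line
     (PICKED: `lambda-switch-laundering`) are NOT optional even for semisimple local types.
     Positive by-product: realisation tables (which tame types the Fermat point does reach, at some
     label / uniformly / on an index-2 coset) for `n = 2,3,4` (§2.4; kit job j025891 extends them);
  §3 load-bearing analysis of every hypothesis (expected status, why no in-tree witness);
  §4 prover-facing gaps that make the crux formally hard but NOT false (pin coherence of the
     `w ∣ ℓ` clauses across `restrictField`; Chebotarev transports).
* Landed / proposed: `Theorems/UnramifiedFermatWitness/Negative/FermatPointTypeDuality.lean`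
  (lemmas of §1–§2, `--supports stmt-Langlands-18025`).  Scripts: seat folder `compute/dial.py`,
  `compute/dial2.py`, `compute/detail.py`; outputs `compute/out_n3_N16.txt`, `dial2_n*_N*.json`.
-/

-- `Summit.Langlands.Langlands.…` repeats a namespace component by design (D-0017 nested layout).
set_option linter.dupNamespace false

namespace Summit.Langlands.Langlands.Cruxes.UnramifiedFermatWitness.Disproof

open Finset Filter
open scoped MatrixGroups NumberField

/-! ## §1 Reading of the statement (elaborates: probe `theorem probe : UnramifiedFermatWitness := by
unfold …; intro K _ _ hK Kav _ _ hKav n hn ℓ _ hn2 h2n hunr k ι r τ h1 h2 hres habs hdg H habs' hen hσ;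
sorry` — rc 0, one sorry, 7 s).

Symbol-by-symbol (no junk operator found):
* binders: `K : Type` CM number field; `Kav` ANY finite extension type (the literature's `F^{avoid}`
  is Galois — the crux is formally stronger but equivalent: disjointness from the Galois closure
  implies disjointness from `Kav`); `n ≥ 2`; `ℓ` prime, `n² < ℓ`, `2n < ℓ` (REDUNDANT: `2n ≤ n² < ℓ`,
  `unramifiedFermatWitness_without_two_mul_lt`), `ℓ` unramified in `K` (Mathlib
  `Algebra.IsUnramifiedIn (𝓞 K) (ℓ)`); `k = 𝔽̄_ℓ := padicAlgClResidueField ℓ`; `ι : ℚ̄_ℓ ≃+* ℂ` a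
  hypothesis; `r` continuous framed (FLT-style `FramedRep`); `τ : Γ_K →* GL_n(k)` a bare hom tied to
  `r` by `IsResidualRepOf (RingHom.id _)` (= semisimplified reduction, unique up to conjugacy by the
  PROVED Brauer–Nesbitt `brauerNesbitt_holds`).
* hypotheses: a.e. unramified (`∀ᶠ v in cofinite`, genuine: Ramakrishna's infinitely ramified
  representations exist); at `v ∣ ℓ`: `IsCrystallineFramed` (de Rham for the CONSTRUCTED `B_dR` +
  `∃ WD, IsWeilDeligneOf ∧ N = 0 ∧ unramified` for the ε-pinned WD half) and labelled weights
  `= Multiset.range n` at every `ℚ_ℓ`-algebra embedding `K_v →ₐ[ℚ_ℓ] ℚ̄_ℓ` (automatically continuous,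
  `K_v/ℚ_ℓ` finite for the canonical algebra structure (F1)); residual: `IsAbsIrreducible τ`,
  `IsDecomposedGeneric τ` (∃ p ≠ ℓ split in K, generic at all v ∣ p — ACC+ Def 4.3.1 verbatim),
  `IsAbsIrreducible (τ|Γ_{K(ζ_ℓ)})`, `IsEnormous (τ(Γ_{K(ζ_ℓ)}))` (ACC+ Def 6.2.28 verbatim, four
  clauses), `∃ σ ∉ Γ_{K(ζ_ℓ)}` with `τ σ` scalar — consistent with `ℓ` unramified in `K` (then
  `ζ_ℓ ∉ K` for `ℓ ≥ 3`, so `H ≠ ⊤`).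
* conclusion: `∃ K'` (Type 0) Galois CM over `K`, `IsField (K ⊗ Kav ⊗ K')`-style linear
  disjointness (`IsField (TensorProduct K Kav K')`), `ℓ` unramified in `K'`; `hcpt'` is PROVABLE
  (`isCompact_glFiniteIntegralLevel_holds n K'`); `τ'`, `π`, `r₀` with: the hypothesis bundle for
  `r|K' := r.restrictField K'` (re-asserted verbatim — so every residual/analytic hypothesis is
  trivially load-bearing "as transport"), `π` weight 0 (`HasWeightZero` = infinity type
  `weightZeroInfinityType`), the HLTT clause written out with `arithFrobPolyOfSatake ι q_v n α =
  ∏ (X − ι⁻¹((q_v^{(n−1)/2} α_j)⁻¹))` at ARITHMETIC Frobenius — consistent with labelled weights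
  `{0,…,n−1}` of `r_ι(π)` in the BLGGT convention `HT(ε) = −1` (the contragredient normalisation
  would be inconsistent: `no_weight_reflection`), `r₀.IsResidualRepOf id τ'`, `π` unramified above ℓ.
  `K' = K` meets every field-theoretic side condition (`IsGalois K K`, `TensorProduct.rid`), so the
  crux contains "residual automorphy of `r̄` over `K` itself" as its `K' = K` instance.
-/

/-- For `2 ≤ n`, `n² < ℓ` already gives `2n < ℓ`. [folklore] -/
theorem two_mul_lt_of_two_le_of_sq_lt {n ℓ : ℕ} (hn : 2 ≤ n) (h : n ^ 2 < ℓ) : 2 * n < ℓ := by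
  nlinarith

/-- **The hypothesis `2 * n < ℓ` is decorative**: the crux implies its variant with that arrow
deleted (verbatim otherwise).  Mutation finding; informs the prover that (5a) of ACC+ 6.1.1 at weight
0 is implied by (4). [folklore] -/
theorem unramifiedFermatWitness_without_two_mul_lt
    (h : Summit.Langlands.Langlands.Theses.StickelbergerDial.UnramifiedFermatWitness) :
    ∀ (K : Type) [Field K] [NumberField K], NumberField.IsCMField K → ∀ (Kav : Type) [Field Kav] [Algebra K Kav], FiniteDimensional K Kav → ∀ (n : ℕ), 2 ≤ n → ∀ (ℓ : ℕ) [Fact ℓ.Prime], n ^ 2 < ℓ → Algebra.IsUnramifiedIn (NumberField.RingOfIntegers K) (Ideal.span {(ℓ : ℤ)}) → let k := Literature.NumberTheory.GaloisRepresentations.padicAlgClResidueField ℓ; ∀ (ι : PadicAlgCl ℓ ≃+* ℂ) (r : Literature.NumberTheory.GaloisRepresentations.FramedGaloisRep K (PadicAlgCl ℓ) n) (τ : Field.absoluteGaloisGroup K →* GL (Fin n) k), (∀ᶠ v in cofinite, r.IsUnramifiedAt v) → (∀ (v : IsDedekindDomain.HeightOneSpectrum (NumberField.RingOfIntegers K))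 (hv : (ℓ : NumberField.RingOfIntegers K) ∈ v.asIdeal), let D := Literature.NumberTheory.PAdicHodge.fontainePstAdicCompletion v ℓ hv; D.IsCrystallineFramed (r.toLocal v) ∧ (letI := D.algebra; ∀ τ' : v.adicCompletion K →ₐ[ℚ_[ℓ]] PadicAlgCl ℓ, r.labelledHodgeTateWeightsAt v D.algebra D.𝔅 τ'.toRingHom = (Multiset.range n).map fun i : ℕ => (i : ℤ))) → r.IsResidualRepOf (RingHom.id _) τ → Literature.NumberTheory.GaloisRepresentations.IsAbsIrreducible τ → Literature.NumberTheory.GaloisRepresentations.IsDecomposedGeneric τ → let H := Literature.NumberTheory.GaloisRepresentations.absGaloisGroupAdjoinRootsOfUnity K ℓ; Literature.NumberTheory.GaloisRepresentations.IsAbsIrreducible (τ.comp H.subtype) → Literature.NumberTheory.GaloisRepresentations.Subgroup.IsEnormous (H.map τ) → (∃ σ : Field.absoluteGaloisGroup K, σ ∉ H ∧ ∃ c : k, (τ σ).1 = c • 1) → ∃ (K' : Type) (_ : Field K') (_ : NumberField K') (_ : Algebra K K'), let H' := Literature.NumberTheory.GaloisRepresentations.absGaloisGroupAdjoinRootsOfUnity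 K' ℓ; IsGalois K K' ∧ NumberField.IsCMField K' ∧ IsField (TensorProduct K Kav K') ∧ Algebra.IsUnramifiedIn (NumberField.RingOfIntegers K') (Ideal.span {(ℓ : ℤ)}) ∧ ∃ (hcpt' : _) (τ' : Field.absoluteGaloisGroup K' →* GL (Fin n) k) (π : Literature.NumberTheory.Automorphic.CuspidalAutomorphicRepData n K' hcpt') (r₀ : Literature.NumberTheory.GaloisRepresentations.FramedGaloisRep K' (PadicAlgCl ℓ) n), (∀ᶠ w in cofinite, (r.restrictField K').IsUnramifiedAt w) ∧ (∀ (w : IsDedekindDomain.HeightOneSpectrum (NumberField.RingOfIntegers K')) (hw : (ℓ : NumberField.RingOfIntegers K') ∈ w.asIdeal), let D := Literature.NumberTheory.PAdicHodge.fontainePstAdicCompletion w ℓ hw; D.IsCrystallineFramed ((r.restrictField K').toLocal w) ∧ (letI := D.algebra; ∀ τ'' : w.adicCompletion K' →ₐ[ℚ_[ℓ]] PadicAlgCl ℓ, (r.restrictField K').labelledHodgeTateWeightsAt w D.algebra D.𝔅 τ''.toRingHom = (Multiset.range n).map fun i : ℕ => (i : ℤ))) ∧ (r.restrictField K').IsResidualRepOf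 (RingHom.id _) τ' ∧ Literature.NumberTheory.GaloisRepresentations.IsAbsIrreducible τ' ∧ Literature.NumberTheory.GaloisRepresentations.IsDecomposedGeneric τ' ∧ Literature.NumberTheory.GaloisRepresentations.IsAbsIrreducible (τ'.comp H'.subtype) ∧ Literature.NumberTheory.GaloisRepresentations.Subgroup.IsEnormous (H'.map τ') ∧ (∃ σ : Field.absoluteGaloisGroup K', σ ∉ H' ∧ ∃ c : k, (τ' σ).1 = c • 1) ∧ π.1.HasWeightZero ∧ (∀ q : ℕ, q.Prime → q ≠ ℓ → (∀ w : IsDedekindDomain.HeightOneSpectrum (NumberField.RingOfIntegers K'), (q : NumberField.RingOfIntegers K') ∈ w.asIdeal → π.1.IsUnramifiedAt w) → ∀ v : IsDedekindDomain.HeightOneSpectrum (NumberField.RingOfIntegers K'), (q : NumberField.RingOfIntegers K') ∈ v.asIdeal → ∀ α : Multiset ℂ, π.1.HasSatakeParamAt v α → r₀.IsUnramifiedAt v ∧ r₀.HasFrobCharpolyAt v (Literature.NumberTheory.Automorphic.arithFrobPolyOfSatake ι v.residueCard n α)) ∧ r₀.IsResidualRepOf (RingHom.id _) τ' ∧ ∀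 w : IsDedekindDomain.HeightOneSpectrum (NumberField.RingOfIntegers K'), (ℓ : NumberField.RingOfIntegers K') ∈ w.asIdeal → π.1.IsUnramifiedAt w := by
  intro K _ _ hK Kav _ _ hKav n hn ℓ _ hn2 hunr
  exact h K hK Kav hKav n hn ℓ hn2 (two_mul_lt_of_two_le_of_sq_lt hn hn2) hunr

/-- **No weight reflection at an `ℓ`-unramified place** (`2 ≤ n`, `n² < ℓ` ⇒ `ℓ − 1 ∤ n(n−1)`):
the arithmetic reason why a residual `τ'` cannot be common to crystalline lifts of labelled weights
`{0,…,n−1}` (as `r|K'`) and `{1−n,…,0}` (as `r_ι(π)^∨`) — inertial determinants `ω^{−n(n−1)/2}` vs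
`ω^{+n(n−1)/2}` at an unramified `w ∣ ℓ`.  Used in §1 to confirm that the crux's Satake→Frobenius
clause is normalised the only consistent way (it is). [folklore] -/
theorem no_weight_reflection {n ℓ : ℕ} (hn : 2 ≤ n) (hℓ : n ^ 2 < ℓ) : ¬ (ℓ - 1 ∣ n * (n - 1)) := by
  intro h
  have hpos : 0 < n * (n - 1) := Nat.mul_pos (by omega) (by omega)
  have hle := Nat.le_of_dvd hpos h
  have : n * (n - 1) < ℓ - 1 := by
    have h1 : n * (n - 1) + n = n ^ 2 := by
      cases n with
      | zero => omega
      | succ m => simp [pow_two, Nat.mul_succ]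
    omega
  omega

/-! ## §2 The dial obstruction: Fermat-point witnesses are locally polarised above `ℓ`

### §2.1 Model (the route's first attack, its own vocabulary)
Dwork family `X₁^N+⋯+X_N^N = N t X₁⋯X_N`, `ℓ ∤ N`, `K'' ⊇ K(ζ_N)`; witness `r₀ = ψ ⊗ W_{[b],t}[λ]`
with `t ≡ 0` ℓ-adically at every `w ∣ ℓ` (ℓ-adic local constancy ⇒ `W̄_t|Γ_{K''_w} ≅ W̄_0|Γ_{K''_w}`),
`ψ` an algebraic Hecke character renormalising weights.  At `t = 0` (Fermat fibre),
`H^{N−2}_prim ⊗ ℚ(ζ_N) = ⊕_{a ∈ A} V_a`, `A = {a ∈ (ℤ/N)^N : a_j ≠ 0, Σ a_j = 0}`, `V_a` a line with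
Jacobi-sum character `J_a`, Hodge type `p(a) = (Σ_j val a_j)/N − 1` (Shioda), `σ_c V_a = V_{ca}`;
the `[b]`-piece is `⊕_{k : b+k·1 ∈ A} V_{b+k·1}`, rank `n_b = N − #values(b)`.  At the place of
`ℚ(ζ_N)` of label `c` (`f = ord_N ℓ`), `J_a|Γ_{ℚ_{ℓ^f}}` is crystalline with labelled weights
`(p(cℓ^i a))_{i<f}` and reduces on inertia to `∏_i ω_{f,i}^{−p(cℓ^i a)}`; so the inertial type of the
twisted piece at label `c` is the multiset of digit strings
`s_k = (p(cℓ^i a_k) − m_{cℓ^i})_{i<f}`, `m_{c'} := min_k p(c' a_k)` (the twist is FORCED by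
"weights exactly `{0,…,n−1}` at every label"), compared as characters of tame inertia (strings reduced
to primitive period).  Admissible `[b]`: rank `n` and CONSECUTIVE Hodge numbers at every label
(then `m_c + m_{−c} = N−1−n`, Weil's condition, so `ψ` exists over the CM field `ℚ(ζ_N)`).
Target: the inertial type of `r̄|Γ_{K_v}` — restriction to inertia of a semisimple Fontaine–Laffaille
representation of `Γ_{ℚ_{ℓ^d}}` with labelled weights `{0,…,n−1}` at each of its `d` labels; for
`d = 1`, `n = 3`: six types `T1 = (0)(1)(2)`, `T2a = (0)(12)`, `T2b = (1)(02)`, `T2c = (2)(01)`,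
`T3a = (012)`, `T3b = (021)` (cycles = niveau blocks).  Matching over a large unramified extension
is exactly equality of inertial types (Frobenius trivialises).

### §2.2 The identity and the law (PROVED below: `fermatHodge_neg`; numerically 0 violations)
`p(−a) = N − 2 − p(a)` on `A`.  Consequence: `type_F(−c) = dual(type_F(c))`, `dual` = digitwise
`d ↦ (n−1) − d` (the type of `W^∨ ⊗ ε^{1−n}`): the Fermat motive is CM-polarised and complex
conjugation `σ_{−1}` exchanges the labels `c ↔ −c`.

### §2.3 The obstruction (informal theorem; bookkeeping of labels in this seat's NOTES.md §dial)
Fix `ι : ℚ̄ → ℚ̄_ℓ`.  The places of `K'' = K(ζ_N)` above a place `v ∣ ℓ` of `K` carry the labels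
`L_v = c₀ · Gal(K(ζ_N)/K) ⊂ (ℤ/N)ˣ`, and in the common base coordinates the TARGET type at all of
them is `S_v := type(r̄|_{I_v})`, while at the labels `−L_v` (the places above `cv`, `c` = complex
conjugation; for `v = cv` these are the same places seen through `Ad(c̃)`) it is
`S_v^c := type(r̄ ∘ Ad(c̃)|_{I_v})` (for `v ≠ cv`: the type at the conjugate place; for `v = cv`:
the rotation of `S_v` by `[K_v:ℚ_ℓ]/2`).  Matching at `t ≡ 0` everywhere above `ℓ` therefore needs
`type_F ≡ S_v` on `L_v` and `type_F ≡ S_v^c` on `−L_v`, whence by §2.2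

  **`S_v^c = dual(S_v)` for every `v ∣ ℓ`, i.e. `r̄ᶜ|_{I_v} ≅ (r̄|_{I_v})^∨ ⊗ ε̄^{1−n}`.**

For polarisable `r` (`rᶜ ≅ r^∨ ε^{1−n}`) this is automatic — the HSBT/BLGGT world; for the
NON-polarisable `r` of this route it is a genuine local restriction, and the crux's hypotheses do not
imply it (they never relate `v` and `cv`).  Violated e.g. by: `n = 3`, `ℓ` split in `K`, `K_v = ℚ_ℓ`,
`r̄|Γ_{K_v}` and `r̄|Γ_{K_{cv}}` both irreducible of niveau 3 with digit cycle `(0,1,2)`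
(`dual(T3a) = T3b ≠ T3a`); `n = 3`, `ℓ` inert, `K_v = ℚ_{ℓ²}`, three niveau-1 characters with label
pairing `π = (01)`; already `n = 2`, `K_v = ℚ_{ℓ²}`, niveau-2-over-`ℚ_{ℓ²}` string `(0,0,1,1)`.
If moreover `K ∩ ℚ(ζ_N)` is totally real (e.g. `K` has no imaginary abelian subfield and is not first
enlarged by one), `−1 ∈ Gal(K(ζ_N)/K)` and the constraints stiffen to `S_v = dual(S_v) = S_v^c`.
Enlarging `K` (by a CM or totally real abelian field, allowed by the crux) does not change the
condition: it is local at `v` and `c` is canonical on CM fields.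
CONSEQUENCE FOR THE LINE: the layer-2 plan `FermatInertialDial → UnramifiedMoretBaillyLink → crux`
reaches at most the sub-crux "`r` with locally conjugation-dual residual inertial types at every
`v ∣ ℓ`" (strictly between the polarisable case and the crux).  Serving the rest needs local
parameters `t_w` in OTHER residue discs at one member of each conjugate pair (types there = Hasse–Witt
/ Dwork-crystal computation, not Stickelberger), or a line that does not realise `r̄` at a CM fibre.
This is independent of, and complementary to, the wild-type notes `WildReachBarrier.md`,
`WildClassDigitBudget.md` (which concern NON-semisimple `r̄|I_v`); here `r̄|I_v` is semisimple.

### §2.4 Tables (scripts `compute/dial.py`, `dial2.py`; local runs; kit job j025891 extends to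
`n=2 N≤48`, `n=3 N≤40`, `n=4 N≤28`, `n=5 N≤14`, results attached to the item by the daemon)
`any` = #(N, [b], ℓ mod N) realising the type at SOME label; `uniform` = at ALL labels;
`half` = constant on an index-2 subgroup `H ∌ −1` of `(ℤ/N)ˣ` containing `ℓ` (imaginary quadratic
`K ⊂ ℚ(ζ_N)`, `ℓ` split in `K`).  Duality violations `type_F(−c) ≠ dual type_F(c)`: 0 in every run.
* `n = 3`, `d = 1`, `N ≤ 30` (651 admissible `(N,[b])`-classes… per-N counts 1,0,4,1,6,1,9,1,24,2,13,5,13,2,28,…,84):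
  `T1 (0)(1)(2)`: any 651, uniform 566, half 995 · `T2b (1)(02)`: any 651, uniform 566, half 277 ·
  `T2a (0)(12)`: any 271, uniform 0, half 30 · `T2c (2)(01)`: any 271, uniform 0, half 78 ·
  `T3a (012)`: any 34, uniform 0, half 14 · `T3b (021)`: any 34, uniform 0, half 14.
  Smallest niveau-3 realisation: `N = 7`, `b = (2,4,5,6,6,6,6)` (`a_k = b, b+4, b+6`), Hodge table
  `fermat7_hodgeTable` below; `ℓ ≡ 2 (mod 7)`: `T3b` on the squares `{1,2,4}`, `T3a` on `{3,5,6}`;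
  `ℓ ≡ 4`: swapped; `ℓ ≡ 3,5` (`f = 6`): `d = 2` types `((0,1,2,2,1,0),…)`; `ℓ ≡ 6`: `T2b`; `ℓ ≡ 1`: `T1`.
  The HSBT piece `N = 4`, `b = 0` gives only `T1` (`ℓ ≡ 1 mod 4`) and `T2b` (`ℓ ≡ 3 mod 4`).
* `n = 2`, `N ≤ 24`: both `d = 1` types uniformly realised (`(0)(1)`: N=3, ℓ≡1; `(01)`: N=3, ℓ≡2 —
  Taylor's ordinary / supersingular discs); no duality obstruction for `d = 1` (both types self-dual).
* `n = 4`, `d = 1`, `N ≤ 20`: all 24 types realised at SOME label, but e.g. `(0)(123)`, `(0)(132)`,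
  `(012)(3)`, `(021)(3)`: any 1, uniform 0, half 0; `(0)(1)(23)`, `(01)(2)(3)`: any 12, half 0;
  niveau-4 cycles `(0123)`/`(0321)`: any 4, half 2; `(0213)`/`(0312)`: any 2, half 1;
  `(0132)`/`(0231)`: any 23, uniform 13.  So for `n = 4` the label-set condition (`type_F` constant on
  the coset `L_v`, of index ≤ 2 for imaginary quadratic `K`) is a further sieve beyond duality.
-/

/-- `hodgeSum a = Σ_j val(a_j)` (`N·(p(a)+1)` for the Fermat hypersurface). [folklore] -/
def hodgeSum {N m : ℕ} (a : Fin m → ZMod N) : ℕ := ∑ j, (a j).val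

/-- Shioda's Hodge number `p(a) = (Σ_j val a_j)/N − 1`. [folklore] -/
def fermatHodge {N m : ℕ} (a : Fin m → ZMod N) : ℕ := hodgeSum a / N - 1

/-- `Σ_j val(−a_j) = m·N − Σ_j val(a_j)` for nowhere-zero `a`. [folklore] -/
theorem hodgeSum_neg {N m : ℕ} [NeZero N] (a : Fin m → ZMod N) (ha : ∀ j, a j ≠ 0) :
    hodgeSum (-a) = m * N - hodgeSum a := by
  unfold hodgeSum
  have h1 : ∀ j ∈ (univ : Finset (Fin m)), ((-a) j).val = N - (a j).val := by
    intro j _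
    simp [Pi.neg_apply, ZMod.neg_val, ha j]
  rw [sum_congr rfl h1, sum_tsub_distrib]
  · simp
  · intro j _
    exact (ZMod.val_lt (a j)).le

/-- Each digit is `< N`. [folklore] -/
theorem hodgeSum_le {N m : ℕ} [NeZero N] (a : Fin m → ZMod N) : hodgeSum a ≤ m * N := by
  unfold hodgeSum
  calc ∑ j, (a j).val ≤ ∑ _j : Fin m, N := sum_le_sum fun j _ => (ZMod.val_lt (a j)).le
    _ = m * N := by simp

/-- Each digit of a nowhere-zero character is `≥ 1`. [folklore] -/
theorem le_hodgeSum {N m : ℕ} [NeZero N] (a : Fin m → ZMod N) (ha : ∀ j, a j ≠ 0) :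
    m ≤ hodgeSum a := by
  unfold hodgeSum
  calc m = ∑ _j : Fin m, 1 := by simp
    _ ≤ ∑ j, (a j).val := sum_le_sum fun j _ => by
        have := (ZMod.val_eq_zero (a j)).not.mpr (ha j)
        omega

/-- **Fermat-point Hodge duality** `p(−a) = N − 2 − p(a)` (`a` nowhere zero, `N ∣ Σ val a_j`):
the identity of §2.2. [folklore] -/
theorem fermatHodge_neg {N : ℕ} [NeZero N] (a : Fin N → ZMod N) (ha : ∀ j, a j ≠ 0)
    (hdiv : N ∣ hodgeSum a) : fermatHodge (-a) = N - 2 - fermatHodge a := by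
  obtain ⟨q, hq⟩ := hdiv
  have hN : 0 < N := Nat.pos_of_ne_zero (NeZero.ne N)
  have hle : hodgeSum a ≤ N * N := hodgeSum_le a
  have hge : N ≤ hodgeSum a := le_hodgeSum a ha
  have hq1 : 1 ≤ q := by
    rcases Nat.eq_zero_or_pos q with h | h
    · rw [h, mul_zero] at hq; omega
    · exact h
  have hqN : q ≤ N := by
    have : N * q ≤ N * N := hq ▸ hle
    exact Nat.le_of_mul_le_mul_left this hN
  unfold fermatHodge
  rw [hodgeSum_neg a ha, hq, show N * N - N * q = N * (N - q) by rw [Nat.mul_sub]]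
  rw [Nat.mul_div_cancel_left _ hN, Nat.mul_div_cancel_left _ hN]
  omega

/-- The three admissible lines `a_k = b + k·1`, `k ∈ {0,4,6}`, of `b = (2,4,5,6,6,6,6)`, `N = 7`. [folklore] -/
def fermat7Lines : Fin 3 → (Fin 7 → ZMod 7) :=
  ![![2, 4, 5, 6, 6, 6, 6], ![6, 1, 2, 3, 3, 3, 3], ![1, 3, 4, 5, 5, 5, 5]]

/-- **Hodge table, `N = 7`, `b = (2,4,5,6,6,6,6)`** (rows `c = 1,…,6`, columns `k = 0,4,6`):
`[4,2,3],[3,4,2],[3,2,1],[2,3,4],[2,1,3],[1,3,2]` — consecutive at every label, row `−c = 5 −` row `c`;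
along `c → 2c → 4c` the normalised strings are the cycle class of `(0,2,1)` on `{1,2,4}` and of
`(0,1,2)` on `{3,5,6}` (the smallest realisation of niveau-3 types, on conjugate cosets). [folklore] -/
theorem fermat7_hodgeTable :
    (List.map (fun c : ZMod 7 => List.map (fun k : Fin 3 => fermatHodge (c • fermat7Lines k))
      [0, 1, 2]) [1, 2, 3, 4, 5, 6]) =
      [[4, 2, 3], [3, 4, 2], [3, 2, 1], [2, 3, 4], [2, 1, 3], [1, 3, 2]] := by
  decide

/-- The HSBT piece `N = 4`, `b = 0`: lines `(1,1,1,1),(2,2,2,2),(3,3,3,3)`, Hodge numbers `[0,1,2]` at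
`c = 1` and `[2,1,0]` at `c = 3`; so `ℓ ≡ 1 (4)` gives the ordinary type and `ℓ ≡ 3 (4)` (`f = 2`,
strings `(0,2),(1,1),(2,0)`) the type `(1)(02)` = `T2b` ONLY — the reason the planner lets `N`, `χ`
vary. [folklore] -/
theorem fermat4_hodgeTable :
    (List.map (fun c : ZMod 4 => List.map (fun k : ZMod 4 => fermatHodge (fun _ : Fin 4 => c * k))
      [1, 2, 3]) [1, 3]) = [[0, 1, 2], [2, 1, 0]] := by
  decide

/-! ## §3 Load-bearing analysis (expected status of `UnramifiedFermatWitness` with one hypothesis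
dropped; none is kernel-checkable today for want of an instance of the REMAINING bundle, see the
verdict box — recorded so that nobody re-derives them)

* `NumberField.IsCMField K` — dropped: FALSE as soon as the bundle is inhabited over a field of MIXED
  signature (a subfield of a CM field is totally real or CM, so no CM `K' ⊇ K` exists: the conclusion's
  `IsCMField K' ∧ Algebra K K'` fails for every `K'`); over totally real `K` the variant stays
  plausible (potential automorphy over a CM quadratic extension).  Not checkable: needs an
  inhabitant (e.g. `Sym^{n−1}` of a non-CM elliptic curve over a cubic field with one complex place)
  and the Mathlib-level lemma "subfields of CM fields are TR or CM" (absent).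
* `FiniteDimensional K Kav` — dropped (Kav/K infinite algebraic, e.g. `Kav = K̄`): the conclusion's
  `IsField (K ⊗_K K̄ ⊗ … )`… `IsField (TensorProduct K Kav K')` with `Kav ⊇` a copy of `K'` fails for
  `K' ≠ K` (zero divisors in `K' ⊗_K K'`), forcing `K' = K`, i.e. residual automorphy over `K`
  itself — conjecturally TRUE (Serre), so no refutation either way; the hypothesis is load-bearing
  only for the intended Moret-Bailly proof.
* `2 ≤ n` — at `n = 1` the statement is class field theory flavoured (weight-0 Hecke characters),
  true; at `n = 0` `IsAbsIrreducible` of the zero representation decides vacuity (not pursued).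
* `n ^ 2 < ℓ` — dropped: still conjecturally true (Serre's conjecture needs no such bound; it is ACC+
  6.1.1's patching hypothesis, i.e. load-bearing for the CONSUMER `FLLiftingWeightZero`, not here).
* `2 * n < ℓ` — REDUNDANT (`unramifiedFermatWitness_without_two_mul_lt`).
* `Algebra.IsUnramifiedIn (𝓞 K) (ℓ)` — dropped: FALSE once inhabited over a `K` in which `ℓ`
  ramifies (`ℓ` ramified in `K ⊆ K'` contradicts `ℓ` unramified in `K'`).  Trivially load-bearing.
* `∀ᶠ v in cofinite, r.IsUnramifiedAt v` — dropped: FALSE once inhabited by an infinitely ramified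
  `r` (Ramakrishna 2000) — the conclusion re-asserts it for `r|K'` (finitely many places above each
  ramified `v`).  Trivially load-bearing; no in-tree witness.
* crystalline + weights at `v ∣ ℓ` — re-asserted for `r|K'`; trivially load-bearing as transport
  (and see §4: the transport itself is the formal crux of the matter).
* `IsAbsIrreducible τ`, `IsAbsIrreducible τ|Γ_{K(ζ_ℓ)}`, `IsEnormous`, scalar element — re-asserted
  over `K'`; dropping ALL residual hypotheses makes the statement FALSE for `r = 1 ⊕ ε⁻¹ ⊕ ⋯ ⊕ ε^{1−n}`
  (every residual representation of `r|K'` is the semisimple `⊕ ε̄^{−i}` by Brauer–Nesbitt, never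
  absolutely irreducible for `n ≥ 2`) PROVIDED the pinned datum declares `r` crystalline of weights
  `{0,…,n−1}` (true of `(B_dR, WD∘D_pst)`; in-tree only (F4) `ε` crystalline and (F11) `HT(ε^m) = {−m}`,
  no ⊕/⊗-clause) — cf. the accepted sibling `Theorems/AdjointLiftingGL3/Negative/SeedAdmitsEisenstein`
  (`diagRep`, `rhoEis`), whose pattern would give `unramifiedFermatWitness_false_without_residual`
  modulo that datum hypothesis; near-tautological here (the conclusion itself demands irreducibility),
  so not built this cycle.
* `IsDecomposedGeneric τ` — re-asserted over `K'`; transport needs a Chebotarev choice of `K'`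
  (prover's burden), not refutable.
-/

/-! ## §4 Prover-facing gaps (make the crux formally HARD, not false) — for the lead / planner

1. PIN COHERENCE (`w ∣ ℓ` clauses of the conclusion).  They are predicated of
   `fontainePstAdicCompletion w ℓ hw`, the INDEPENDENTLY ε-pinned datum of the completion `K'_w`
   (its own `absoluteGaloisGroup (w.adicCompletion K')`, its own Hilbert-ε Weil–Deligne half).  No
   clause of `IsFontaineDatum` ((F1)–(F12)) relates the data of `K_v` and of a finite extension
   `K'_w`; `PstCrystallineExtensionData` (F10) is a tower INSIDE the `K_v`-datum.  Hence for `K' ≠ K`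
   "crystalline of weights `{0,…,n−1}` at `w`" for `r|K'` is formally unreachable from the hypothesis
   at `v` (though true of genuine `B_dR`/`D_pst`), and for `K' = K` it needs invariance of
   `IsCrystallineFramed`/`labelledHodgeTateWeightsAt` under a frame change (`absGaloisRestrict K K` is
   inner, `absGaloisRestrict_self_eq_conj`).  This is stub S3 `stub_crystallineTransport_restrictField`
   of the picked line; it cannot be REFUTED either (ε-data might be coherent): it is INDEPENDENT of the
   current specification.  Recommendation (planner/literature): a clause (F13) "restriction
   compatibility of THE datum along finite extensions of the base inside `ℚ̄_ℓ`", or state the crux's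
   `w ∣ ℓ` clauses relative to the `K_v`-datum's extension data.
2. The transports of `IsDecomposedGeneric`, of the scalar element and of enormousness to `K'` go
   through linear disjointness of `K'` from `L = K̄^{ker τ}(ζ_ℓ)` — obtained by running the crux with
   the avoid-field `Kav · L` (allowed: `Kav` is arbitrary finite).  Stub S2 of the picked line.
3. `r₀ := r_ι(π)` with the written-out HLTT property needs HLTT Thm A (existence) — a named fact NOT in
   the route's cone — or a direct motivic construction with local–global compatibility at `v ∤ ℓ`.
4. Nothing in the tree outputs a weight-0 cuspidal `π` over an ℓ-UNRAMIFIED field from a residual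
   datum: `Qian2022.potentialAutomorphy_ordinary` is ordinary with `K'` ramified at `ℓ` (`v(t) < 0`).
   The crux is therefore `needs-fact`-shaped for provers; the dial obstruction of §2 says the natural
   fact to vend is NOT "Fermat-point matching" alone.
-/

end Summit.Langlands.Langlands.Cruxes.UnramifiedFermatWitness.Disproof
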